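import Literature.Geometry.Lorentzian.PlaneWave
import Literature.Geometry.Lorentzian.SpacetimeLocalConvergence
import Literature.Geometry.Lorentzian.BilinPullbackEstimates
import HarnessLib

/-!
# Pointed `Cᵏ_loc` limits of spacetimes are not unique: the plane wave has Minkowski space as a limit
(topic `Geometry/Lorentzian`; Geroch 1969, "Limits of spacetimes", §3 (hereditary properties and
the non-Hausdorff nature of limits); Penrose 1976 (plane-wave limits); for the notion of limit:
`Spacetime.SubconvergesLocallyTo`, `SpacetimeLocalConvergence.lean`, Petersen 2006, Ch. 10, §3.2)

**Theorem (`PlaneWave.minkowskiLimit`, `PlaneWave.subconvergesLocallyTo_minkowski`).** The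
CONSTANT sequence `n ↦ (𝓟, 0)`, `𝓟` the homogeneous vacuum plane wave
`η + ((x¹)² − (x²)²)(dx⁰ − dx³)²` (`PlaneWave.spacetime`, not flat), converges in the pointed
`Cᵏ_loc` sense of `Spacetime.SubconvergesLocallyTo` to MINKOWSKI space `(ℝ⁴₁, 0)`, for every `k`:
the comparison maps are the null boosts `boost cₙ`, `cₙ = 1/(2(n+2)) → 0`, which are
diffeomorphisms of `ℝ⁴` fixing `0`, preserve the time orientations on the balls `B(0, n+1)`, and
pull the plane wave back to the plane wave of amplitude `cₙ²` (`PlaneWave.bilin_boost`), whose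
components converge to `η` with all derivatives, uniformly on compact sets
(`supCkENorm K k (cₙ² • F) ≤ cₙ² · C_K → 0`).

Since trivially also `(𝓟, 0) ⇀ (𝓟, 0)` (`SubconvergesLocallyTo.refl`), one constant sequence has
two limits, a curved and a flat one: pointed `Cᵏ_loc` limits of LORENTZIAN manifolds are not
unique up to isometry (for Riemannian manifolds they are, Petersen 2006, Ch. 10), because the
comparison maps may degenerate through the non-compact Lorentz group. The obstruction to such a
degeneration at the `C²` level is a non-zero boost-invariant curvature scalar; for the plane wave
(Petrov type N) all of them vanish. Consequences for hull / limit-set notions built on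
`SubconvergesLocallyTo` (Final State Conjecture routes): "the" limit along an extraction is not
well defined, and hull-level statements must be invariant under adjoining such degenerate limits.

## References
* [Geroch1969] R. Geroch, *Limits of spacetimes*, Comm. Math. Phys. 13 (1969) 180–193, §3
  (doi:10.1007/BF01645486).
* R. Penrose, *Any space-time has a plane wave as a limit*, in: Differential Geometry and
  Relativity (Cahen, Flato eds.), Reidel 1976, 271–275.
* [Petersen2006] P. Petersen, *Riemannian Geometry*, 2nd ed., GTM 171, Springer 2006, Ch. 10, §3.2.
-/

noncomputable section

-- the normed-space instances on `E4 →L[ℝ] E4 →L[ℝ] ℝ`(-valued multilinear maps) need one more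
-- level of pending instance problems than the default (as in `BoundedGeometry.lean`)
set_option maxSynthPendingDepth 3

open TopologicalSpace Manifold Filter Topology Set Function Metric Bundle
open scoped ContDiff Topology ENNReal

namespace Literature.Geometry.Lorentzian

namespace PlaneWave

/-! ### Minkowski space in its global chart (a reducible copy) -/

/-- Minkowski spacetime, as a REDUCIBLE bundled `Spacetime 4` (definitionally equal to
`Minkowski.spacetime`, `flat_eq`; the `abbrev` makes `flat.carrier` and its instances reducibly
those of `E4`, so that the global chart is the identity by `chartAt_self_eq`). [folklore] -/
abbrev flat : Spacetime 4 where
  carrier := E4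
  metric := Minkowski.metric.ofLE le_top
  timeOrientation := Minkowski.timeOrientation.ofLE le_top

/-- The reducible copy is Minkowski spacetime. [folklore] -/
theorem flat_eq : flat = Minkowski.spacetime := rfl

/-! ### The boost parameters and the exhaustion -/

/-- The boost parameters `cₙ = 1/(2(n+2))`. [folklore] -/
def boostParam (n : ℕ) : ℝ := (2 * ((n : ℝ) + 2))⁻¹

/-- `cₙ > 0`. [folklore] -/
theorem boostParam_pos (n : ℕ) : 0 < boostParam n := by
  unfold boostParam
  positivity

/-- `cₙ ≠ 0`. [folklore] -/
theorem boostParam_ne_zero (n : ℕ) : boostParam n ≠ 0 := (boostParam_pos n).ne'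

/-- `cₙ (n + 1) ≤ 1/2`. [folklore] -/
theorem boostParam_mul_le (n : ℕ) : boostParam n * ((n : ℝ) + 1) ≤ 1 / 2 := by
  unfold boostParam
  rw [inv_mul_le_iff₀ (by positivity)]
  linarith

/-- `cₙ → 0`. [folklore] -/
theorem tendsto_boostParam : Tendsto boostParam atTop (𝓝 0) := by
  have h : Tendsto (fun n : ℕ ↦ 2 * ((n : ℝ) + 2)) atTop atTop :=
    (tendsto_atTop_add_const_right _ _ tendsto_natCast_atTop_atTop).const_mul_atTop two_pos
  exact h.inv_tendsto_atTop

/-- The **exhaustion** of Minkowski space by the balls `B(0, n+1)`. [folklore] -/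
def exhaustion (n : ℕ) : Opens flat.carrier := ⟨ball (0 : E4) ((n : ℝ) + 1), isOpen_ball⟩

/-- Membership in the exhausting balls. [folklore] -/
theorem mem_exhaustion {n : ℕ} {x : E4} :
    x ∈ (exhaustion n : Set flat.carrier) ↔ ‖x‖ < (n : ℝ) + 1 := by
  show x ∈ ball (0 : E4) ((n : ℝ) + 1) ↔ _
  rw [mem_ball_zero_iff]

/-- The profile is bounded by the squared norm: `H(x) ≤ ‖x‖²`. [folklore] -/
theorem profile_le_norm_sq (x : E4) : profile x ≤ ‖x‖ ^ 2 := by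
  have h1 : x 1 ^ 2 ≤ ‖x‖ ^ 2 := by
    have := PiLp.norm_apply_le x 1
    rw [Real.norm_eq_abs] at this
    nlinarith [abs_nonneg (x 1), sq_abs (x 1)]
  unfold profile
  nlinarith [sq_nonneg (x 2)]

/-! ### The comparison maps: orientation -/

/-- The **comparison maps**: the null boosts `boost cₙ`, as maps from (the carrier of) Minkowski
space to (the carrier of) the plane wave. [folklore] -/
def boostEmbed (n : ℕ) : flat.carrier → spacetime.carrier := fun z ↦ boost (boostParam n) z

/-- The comparison maps are the boosts. [folklore] -/
@[simp]
theorem boostEmbed_apply (n : ℕ) (z : E4) : boostEmbed n z = boost (boostParam n) z := rfl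

/-- The differential of the boost is the boost. [folklore] -/
theorem mfderiv_boost (c : ℝ) (y v : E4) :
    mfderiv 𝓘(ℝ, E4) (𝓡 4) (fun z : E4 ↦ (boost c z : spacetime.carrier)) y v = boost c v := by
  rw [show (fun z : E4 ↦ (boost c z : spacetime.carrier)) = ⇑(boost c) from rfl,
    ContinuousLinearMap.mfderiv_eq]
  rfl

/-- **The boosts preserve the time orientations where `c² H < 1`**: `d(boost c)(∂₀) = boost c ∂₀`
is future-directed timelike for the plane wave at `boost c x` as soon as `c² H(x) < 1`
(`g(boost c ∂₀, boost c ∂₀) = −1 + c²H(x)`, `g(T, boost c ∂₀) = −(c + c⁻¹)/2 + cH(x)/2 < −c/2`). [folklore] -/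
theorem isFutureDirected_boost {c : ℝ} (hc : 0 < c) {x : E4} (hx : c ^ 2 * profile x < 1) :
    spacetime.timeOrientation.IsFutureDirected
      (mfderiv 𝓘(ℝ, E4) (𝓡 4) (fun z : E4 ↦ (boost c z : spacetime.carrier)) x
        (E4.basisVector 0)) := by
  rw [mfderiv_boost]
  have hl : ell (E4.basisVector 0) = 1 := by simp [Fin.ext_iff]
  have hn : enn (E4.basisVector 0) = 1 := by simp [Fin.ext_iff]
  have hval : bilin (boost c x) (boost c (E4.basisVector 0)) (boost c (E4.basisVector 0)) =
      -1 + c ^ 2 * profile x := by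
    rw [bilin_boost hc.ne', Minkowski.bilin_basisVector_zero, hl]
    ring
  have hsign : bilin (boost c x) (timeVector (boost c x)) (boost c (E4.basisVector 0)) =
      -(c + c⁻¹) / 2 + c * profile x / 2 := by
    rw [bilin_timeVector_left, boost_apply_zero, profile_boost, ell_boost, hl, hn]
    ring
  have hcH : c * profile x < c⁻¹ := by
    have h1 : c * (c * profile x) < c * c⁻¹ := by
      rw [mul_inv_cancel₀ hc.ne']
      nlinarith
    exact lt_of_mul_lt_mul_left h1 hc.le
  have hne : boost c (E4.basisVector 0) ≠ 0 := fun h0 ↦ by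
    have h1 := congrArg ell h0
    rw [ell_boost, hl, mul_one, map_zero] at h1
    exact hc.ne' h1
  refine ⟨⟨?_, hne⟩, ?_⟩
  · show bilin (boost c x) _ _ ≤ 0
    rw [hval]
    linarith
  · show bilin (boost c x) (timeVector (boost c x)) _ < 0
    rw [hsign]
    nlinarith

/-- On the ball `B(0, n+1)` the `n`-th boost preserves the time orientations. [folklore] -/
theorem isFutureDirected_boostEmbed (n : ℕ) {x : E4} (hx : ‖x‖ < (n : ℝ) + 1) :
    spacetime.timeOrientation.IsFutureDirected
      (mfderiv 𝓘(ℝ, E4) (𝓡 4) (boostEmbed n) x (E4.basisVector 0)) := by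
  refine isFutureDirected_boost (boostParam_pos n) ?_
  have h1 : boostParam n * ‖x‖ ≤ 1 / 2 :=
    (mul_le_mul_of_nonneg_left hx.le (boostParam_pos n).le).trans (boostParam_mul_le n)
  have h2 : (boostParam n * ‖x‖) ^ 2 ≤ (1 / 2) ^ 2 :=
    pow_le_pow_left₀ (mul_nonneg (boostParam_pos n).le (norm_nonneg _)) h1 2
  calc boostParam n ^ 2 * profile x ≤ boostParam n ^ 2 * ‖x‖ ^ 2 :=
        mul_le_mul_of_nonneg_left (profile_le_norm_sq x) (sq_nonneg _)
    _ = (boostParam n * ‖x‖) ^ 2 := by ring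
    _ < 1 := h2.trans_lt (by norm_num)

/-! ### The comparison maps: convergence of the pulled-back metrics -/

/-- The fixed field `F(y) = H(y) ℓ ⊗ ℓ` (the deviation at unit amplitude). [folklore] -/
def deviationField (y : E4) : E4 →L[ℝ] E4 →L[ℝ] ℝ := E4.tmul (profile y • ell) ell

/-- `F(y)(v, w) = H(y) ℓ(v) ℓ(w)`. [folklore] -/
@[simp]
theorem deviationField_apply (y v w : E4) : deviationField y v w = profile y * (ell v * ell w) := by
  rw [deviationField, E4.tmul_apply, smul_apply, smul_eq_mul, mul_assoc]

/-- `F` is analytic (a polynomial field). [folklore] -/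
theorem contDiff_deviationField : ContDiff ℝ ω deviationField := by
  unfold deviationField E4.tmul
  exact (contDiff_profile.smul contDiff_const).smulRight contDiff_const

/-- **The deviation of the boosted plane wave from Minkowski space is `c² • F`**: in the identity
chart of Minkowski space, `(boost cₙ)^* g_𝓟 − η = cₙ² H ℓ ⊗ ℓ`. [folklore] -/
theorem metricInCoords_boostEmbed_sub (n : ℕ) (x : flat.carrier) :
    spacetime.metricInCoords (boostEmbed n ∘ (chartAt E4 x).symm) -
      flat.metricInCoords (chartAt E4 x).symm = boostParam n ^ 2 • deviationField := by
  funext y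
  ext v w
  simp only [chartAt_self_eq, OpenPartialHomeomorph.refl_symm, OpenPartialHomeomorph.refl_apply,
    Function.comp_id, Pi.sub_apply, Pi.smul_apply]
  rw [sub_apply, sub_apply, Spacetime.metricInCoords_apply, Spacetime.metricInCoords_apply,
    mfderiv_id]
  rw [show boostEmbed n = fun z : E4 ↦ (boost (boostParam n) z : spacetime.carrier) from rfl,
    mfderiv_boost, mfderiv_boost]
  show bilin (boost (boostParam n) y) (boost (boostParam n) v) (boost (boostParam n) w) -
    Minkowski.bilin v w = (boostParam n ^ 2 • deviationField y) v w
  rw [bilin_boost (boostParam_ne_zero n), smul_apply, smul_apply, deviationField_apply, smul_eq_mul]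
  ring

/-- An analytic map has all derivatives of order `≤ k` bounded on a compact set. [folklore] -/
theorem exists_forall_norm_iteratedFDeriv_le {E G : Type*} [NormedAddCommGroup E]
    [NormedSpace ℝ E] [NormedAddCommGroup G] [NormedSpace ℝ G] {f : E → G}
    (hf : ContDiff ℝ ω f) {K : Set E} (hK : IsCompact K) (k : ℕ) :
    ∃ C : ℝ, ∀ m, m ≤ k → ∀ y ∈ K, ‖iteratedFDeriv ℝ m f y‖ ≤ C := by
  have hcont : ∀ m : ℕ, ContinuousOn (iteratedFDeriv ℝ m f) K := fun m ↦
    (hf.continuous_iteratedFDeriv (m := m) le_top).continuousOn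
  choose C hC using fun m ↦ hK.exists_bound_of_continuousOn (hcont m)
  refine ⟨∑ i ∈ Finset.range (k + 1), |C i|, fun m hm y hy ↦ ?_⟩
  exact ((hC m y hy).trans (le_abs_self _)).trans (Finset.single_le_sum (f := fun i ↦ |C i|)
    (fun j _ ↦ abs_nonneg (C j)) (Finset.mem_range.mpr (Nat.lt_succ_of_le hm)))

/-- **`Cᵏ` convergence of the deviation**: `supCkENorm K k (cₙ² • F) → 0` on every compact `K`. [folklore] -/
theorem tendsto_supCkENorm_deviation {K : Set E4} (hK : IsCompact K) (k : ℕ) :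
    Tendsto (fun n ↦ supCkENorm K k (boostParam n ^ 2 • deviationField)) atTop (𝓝 0) := by
  obtain ⟨C, hC⟩ := exists_forall_norm_iteratedFDeriv_le contDiff_deviationField hK k
  have hbound : ∀ n, supCkENorm K k (boostParam n ^ 2 • deviationField) ≤
      ENNReal.ofReal (boostParam n ^ 2 * C) := fun n ↦ by
    refine supCkENorm_le_ofReal fun m hm y hy ↦ ?_
    have hsmul : iteratedFDeriv ℝ m (boostParam n ^ 2 • deviationField) y =
        boostParam n ^ 2 • iteratedFDeriv ℝ m deviationField y :=
      iteratedFDeriv_const_smul_apply (a := boostParam n ^ 2)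
        (contDiff_deviationField.of_le le_top).contDiffAt
    rw [hsmul, norm_smul, Real.norm_eq_abs, abs_of_nonneg (sq_nonneg _)]
    exact mul_le_mul_of_nonneg_left (hC m hm y hy) (sq_nonneg _)
  have hlim : Tendsto (fun n ↦ ENNReal.ofReal (boostParam n ^ 2 * C)) atTop (𝓝 0) := by
    rw [← ENNReal.ofReal_zero]
    refine ENNReal.tendsto_ofReal ?_
    simpa using (tendsto_boostParam.pow 2).mul_const C
  exact tendsto_of_tendsto_of_tendsto_of_le_of_le tendsto_const_nhds hlim (fun _ ↦ zero_le)
    hbound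

/-! ### The datum -/

/-- **The plane wave has Minkowski space as a pointed `Cᵏ_loc` limit** (the datum, over the
reducible copy `flat`): constant sequence `(𝓟, 0)`, limit `(ℝ⁴₁, 0)`, exhaustion by the balls
`B(0, n+1)`, comparison maps the null boosts `boost cₙ`, `cₙ = 1/(2(n+2))`. [cite: Petersen2006, Ch. 10 §3.2] -/
def flatLimit (k : ℕ) :
    Spacetime.LocalSubconvergence (fun _ : ℕ ↦ spacetime) (fun _ ↦ (0 : E4)) flat (0 : E4) k where
  sub := id
  strictMono_sub := strictMono_id
  U := exhaustion
  monotone_U := fun n m h ↦ show ball (0 : E4) ((n : ℝ) + 1) ⊆ ball (0 : E4) ((m : ℝ) + 1) from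
    ball_subset_ball (by exact_mod_cast Nat.succ_le_succ h)
  mem_U := by
    show (0 : E4) ∈ ball (0 : E4) (((0 : ℕ) : ℝ) + 1)
    simp
  iUnion_U := by
    refine eq_univ_of_forall fun x ↦ ?_
    obtain ⟨n, hn⟩ := exists_nat_gt ‖x‖
    exact mem_iUnion.2 ⟨n, mem_exhaustion.2 (hn.trans (lt_add_one _))⟩
  isCompact_closure_U := fun n ↦
    show IsCompact (closure (ball (0 : E4) ((n : ℝ) + 1))) from isBounded_ball.isCompact_closure
  embed := boostEmbed
  isLocalDiffeomorphOn_embed := fun n ↦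
    ((boostEquiv (boostParam_ne_zero n)).toDiffeomorph.isLocalDiffeomorph).isLocalDiffeomorphOn _
  injOn_embed := fun n ↦ (boostEquiv (boostParam_ne_zero n)).injective.injOn
  embed_basepoint := fun n ↦ map_zero (boost (boostParam n))
  isFutureDirected_mfderiv_embed := fun n x hx ↦ isFutureDirected_boostEmbed n (mem_exhaustion.1 hx)
  tendsto_supCkENorm := fun x K hK _ ↦
    (tendsto_supCkENorm_deviation hK k).congr fun n ↦
      congrArg (supCkENorm K k) (metricInCoords_boostEmbed_sub n x).symm

/-- The same datum with the limit written as `Minkowski.spacetime`. [cite: Petersen2006, Ch. 10 §3.2] -/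
def minkowskiLimit (k : ℕ) :
    Spacetime.LocalSubconvergence (fun _ : ℕ ↦ spacetime) (fun _ ↦ (0 : E4))
      Minkowski.spacetime (0 : E4) k :=
  flatLimit k

/-- **Pointed `Cᵏ_loc` limits of spacetimes are not unique** (Geroch 1969, §3): the constant
sequence `(𝓟, 0)`, `𝓟` the homogeneous vacuum plane wave, subconverges to MINKOWSKI space
`(ℝ⁴₁, 0)` for every `k` — besides subconverging to `(𝓟, 0)` itself
(`Spacetime.SubconvergesLocallyTo.refl`). [cite: Geroch1969, §3] -/
theorem subconvergesLocallyTo_minkowski (k : ℕ) :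
    Spacetime.SubconvergesLocallyTo (fun _ : ℕ ↦ spacetime) (fun _ ↦ (0 : E4))
      Minkowski.spacetime (0 : E4) k :=
  ⟨minkowskiLimit k⟩

/-- … and, trivially, to itself: ONE constant sequence with TWO pointed `Cᵏ_loc` limits, a curved
one and a flat one. [cite: Geroch1969, §3] -/
theorem subconvergesLocallyTo_self (k : ℕ) :
    Spacetime.SubconvergesLocallyTo (fun _ : ℕ ↦ spacetime) (fun _ ↦ (0 : E4)) spacetime (0 : E4) k :=
  Spacetime.SubconvergesLocallyTo.refl spacetime (0 : E4) k

/-! ### The comparison maps degenerate -/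

/-- `‖boost c ∂₀‖ ≥ c⁻¹/2`: the boosted unit time vector has `x⁰`-component `(c + c⁻¹)/2`. [folklore] -/
theorem inv_le_norm_boost_basisVector_zero {c : ℝ} (hc : 0 < c) :
    c⁻¹ / 2 ≤ ‖boost c (E4.basisVector 0)‖ := by
  have hl : ell (E4.basisVector 0) = 1 := by simp [Fin.ext_iff]
  have hn : enn (E4.basisVector 0) = 1 := by simp [Fin.ext_iff]
  have h0 : boost c (E4.basisVector 0) 0 = (c + c⁻¹) / 2 := by
    rw [boost_apply_zero, hl, hn, mul_one, mul_one]
  have h1 : ‖boost c (E4.basisVector 0) 0‖ ≤ ‖boost c (E4.basisVector 0)‖ := PiLp.norm_apply_le _ 0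
  rw [h0, Real.norm_eq_abs, abs_of_pos (by positivity)] at h1
  linarith

/-- **The comparison maps of the plane-wave-to-Minkowski datum degenerate**: the image of the
unit time vector `∂₀` at the base point under `d(boost cₙ)` has Euclidean norm `≥ n + 2 → ∞`
(while its `η`-length² stays `−1`) — the non-compactness of the Lorentz group at work; a FRAMED
notion of pointed convergence (frames at the base points converging) excludes exactly this. [cite: Geroch1969, §3] -/
theorem tendsto_norm_mfderiv_minkowskiLimit (k : ℕ) :
    Tendsto (fun n : ℕ ↦ ‖(show E4 from mfderiv 𝓘(ℝ, E4) (𝓡 4) ((minkowskiLimit k).embed n)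
      (0 : E4) (E4.basisVector 0))‖) atTop atTop := by
  have h : ∀ n : ℕ, ((n : ℝ) + 2) ≤ ‖(show E4 from mfderiv 𝓘(ℝ, E4) (𝓡 4)
      ((minkowskiLimit k).embed n) (0 : E4) (E4.basisVector 0))‖ := fun n ↦ by
    have hm : (show E4 from mfderiv 𝓘(ℝ, E4) (𝓡 4) ((minkowskiLimit k).embed n) (0 : E4)
        (E4.basisVector 0)) = boost (boostParam n) (E4.basisVector 0) :=
      mfderiv_boost (boostParam n) 0 (E4.basisVector 0)
    rw [hm]
    refine le_trans (le_of_eq ?_) (inv_le_norm_boost_basisVector_zero (boostParam_pos n))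
    rw [boostParam, inv_inv]
    ring
  exact tendsto_atTop_mono h (tendsto_atTop_add_const_right _ _ tendsto_natCast_atTop_atTop)

end PlaneWave

end Literature.Geometry.Lorentzian
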